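import Literature.Probability.Percolation.EnhancedCluster
import HarnessLib

/-!
# The exploratory essential enhancement of Martineau–Severo (2019, §4) for SITE percolation:
# the cluster `𝒞_o(ω, α)` and the event `𝓔_L`

First file of the inline proof of the SITE-percolation version of Martineau–Severo's Corollary 2.2
(`Literature.Probability.Percolation.MartineauSevero2019_cor22_site`, strict monotonicity
`p_c^site(𝒢) < p_c^site(𝒢/Γ)` under quotients by free actions). Martineau–Severo (Ann. Probab. 47 (2019))
state and prove their results for bond percolation and note (§2, Convention; §5, Remark 4; end of §6) that
"our proofs can be adapted to Bernoulli site percolation". This file is the site twin of the tree's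
`EnhancedCluster.lean` (bond): on an arbitrary (connected, locally finite) graph `H` — the quotient `ℋ` in
the application — fix `r`, and for `(ω, α) ∈ {0,1}^{V(ℋ)} × {0,1}^{V(ℋ)}` (`ω` = open SITES, `α` = marks) let
`𝒞_A(ω, α)` be the least set of vertices containing the seed set `A`, closed under
* the site rule: `u ∈ 𝒞`, `u ∼ v`, `v` open ⟹ `v ∈ 𝒞`;
* the bonus rule: `u ∈ 𝒞`, `α_u = 1`, every site of `B_r(u)` open ⟹ every `v` with `d(u,v) = r+1` joins.
Seeds are put in the cluster whatever their state (upstairs the root is declared open and the price is paid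
by insertion tolerance, as in the tree's `CrossoverCoupling.lean`).

* `enhSiteCluster H r A ω α` — `𝒞_A(ω, α)`; monotone (`enhSiteCluster_mono`); a fully open ball around a point
  of the cluster lies in the cluster (`graphBall_subset_enhSiteCluster`).
* Coordinates `W ⊕ W` for the pair `(ω, α)` (`enhSiteOmega`, `enhSiteAlpha`), and the event
  `enhSiteEvent H r o L = 𝓔_L := {∃ v ∈ 𝒞_o(ω,α), dist(o,v) ≥ L}`; increasing (`isUpperSet_enhSiteEvent`) and
  LOCAL: determined by the finite window `enhSiteWindow = B_{L+r}(o) ⊔ B_L(o)` (`determinedBy_enhSiteEvent`),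
  via the closure principle `exists_far_of_siteClosed`.

## References

* S. Martineau, F. Severo, Ann. Probab. 47 (2019), §2 (Convention: "percolation is taken to mean Bernoulli
  bond percolation, but our proofs can be adapted to Bernoulli site percolation"), §4 (definition of
  `𝒞_o(ω,α)`), §5 Remark 4, §6 (`𝓔_L`) [MartineauSevero2019].
* M. Aizenman, G. Grimmett, J. Stat. Phys. 63 (1991) (essential enhancements) [AizenmanGrimmett1991].
-/

namespace Literature.Probability.Percolation

open Literature.Barriers.CriticalPhenomena

variable {W : Type*}

/-! ### The enhanced site cluster `𝒞_A(ω, α)` -/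

/-- The inductive generation of the SITE version of Martineau–Severo's cluster `𝒞_A(ω,α)`: seeds, open
neighbouring sites, and the bonus — from `u` in the cluster with `α_u = 1` and all sites of `B_r(u)` open,
every `v` with `d(u,v) = r+1` joins. [cite: MartineauSevero2019, §4 (definition of 𝒞_o(ω,α)) and §5 Remark 4 (site adaptation)] -/
inductive EnhSiteReach (H : SimpleGraph W) (r : ℕ) (A : Set W) (ω : Set W) (α : Set W) : W → Prop
  | seed {v : W} : v ∈ A → EnhSiteReach H r A ω α v
  | site {u v : W} : EnhSiteReach H r A ω α u → H.Adj u v → v ∈ ω → EnhSiteReach H r A ω α v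
  | bonus {u v : W} : EnhSiteReach H r A ω α u → u ∈ α → graphBall H u r ⊆ ω → H.dist u v = r + 1 →
      EnhSiteReach H r A ω α v

/-- **The enhanced site cluster `𝒞_A(ω, α)`** of the seed set `A` (`𝒞_o = 𝒞_{{o}}`).
[cite: MartineauSevero2019, §4 (𝒞_o(ω,α), 𝒞_A); §5 Remark 4] -/
def enhSiteCluster (H : SimpleGraph W) (r : ℕ) (A : Set W) (ω : Set W) (α : Set W) : Set W :=
  {v | EnhSiteReach H r A ω α v}

/-- Seeds lie in the cluster. [cite: MartineauSevero2019, §4 (C_0 = A)] -/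
theorem subset_enhSiteCluster (H : SimpleGraph W) (r : ℕ) (A : Set W) (ω : Set W) (α : Set W) :
    A ⊆ enhSiteCluster H r A ω α := fun _ hv => EnhSiteReach.seed hv

/-- **Monotonicity** of `𝒞_A(ω,α)` in the seed set, the open sites and the marks.
[cite: MartineauSevero2019, §6 ("increasing in both ω and α")] -/
theorem enhSiteCluster_mono (H : SimpleGraph W) (r : ℕ) {A A' : Set W} {ω ω' : Set W} {α α' : Set W}
    (hA : A ⊆ A') (hω : ω ⊆ ω') (hα : α ⊆ α') : enhSiteCluster H r A ω α ⊆ enhSiteCluster H r A' ω' α' := by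
  intro v hv
  induction hv with
  | seed h => exact EnhSiteReach.seed (hA h)
  | site _ hadj hv ih => exact EnhSiteReach.site ih hadj (hω hv)
  | bonus _ hu hb hd ih => exact EnhSiteReach.bonus ih (hα hu) (hb.trans hω) hd

/-- The site rule. [cite: MartineauSevero2019, §4 (C_{2n+1}); §5 Remark 4] -/
theorem mem_enhSiteCluster_of_adj {H : SimpleGraph W} {r : ℕ} {A : Set W} {ω : Set W} {α : Set W}
    {u v : W} (hu : u ∈ enhSiteCluster H r A ω α) (hadj : H.Adj u v) (hv : v ∈ ω) :
    v ∈ enhSiteCluster H r A ω α :=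
  EnhSiteReach.site hu hadj hv

/-- The bonus rule. [cite: MartineauSevero2019, §4 (C_{2n+2})] -/
theorem mem_enhSiteCluster_of_bonus {H : SimpleGraph W} {r : ℕ} {A : Set W} {ω : Set W} {α : Set W}
    {u v : W} (hu : u ∈ enhSiteCluster H r A ω α) (hα : u ∈ α) (hb : graphBall H u r ⊆ ω)
    (hd : H.dist u v = r + 1) : v ∈ enhSiteCluster H r A ω α :=
  EnhSiteReach.bonus hu hα hb hd

/-- **Induction principle** for membership in `𝒞_A(ω,α)`. [cite: MartineauSevero2019, §4] -/
theorem enhSiteCluster_induction {H : SimpleGraph W} {r : ℕ} {A : Set W} {ω : Set W} {α : Set W}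
    {P : W → Prop} (hseed : ∀ v ∈ A, P v)
    (hsite : ∀ u v, u ∈ enhSiteCluster H r A ω α → P u → H.Adj u v → v ∈ ω → P v)
    (hbonus : ∀ u v, u ∈ enhSiteCluster H r A ω α → P u → u ∈ α → graphBall H u r ⊆ ω → H.dist u v = r + 1 → P v)
    {v : W} (hv : v ∈ enhSiteCluster H r A ω α) : P v := by
  induction hv with
  | seed h => exact hseed _ h
  | site hu hadj hv ih => exact hsite _ _ hu ih hadj hv
  | bonus hu hα hb hd ih => exact hbonus _ _ hu ih hα hb hd

/-- Every non-seed vertex of the cluster entered through the site rule is open: more usefully, a cluster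
vertex is a seed, or open, or was added by a bonus; in particular **if `B_n(u) ⊆ ω` and `u ∈ 𝒞` then
`B_n(u) ⊆ 𝒞`** (walk inwards along open sites). [cite: MartineauSevero2019, §6 ("B_{r+1}(z) is contained in 𝒞_o")] -/
theorem graphBall_subset_enhSiteCluster {H : SimpleGraph W} {r : ℕ} {A : Set W} {ω : Set W} {α : Set W}
    {u : W} {n : ℕ} (hu : u ∈ enhSiteCluster H r A ω α) (hb : graphBall H u n ⊆ ω) :
    graphBall H u n ⊆ enhSiteCluster H r A ω α := by
  suffices h : ∀ k, k ≤ n → graphBall H u k ⊆ enhSiteCluster H r A ω α from h n le_rfl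
  intro k
  induction k with
  | zero =>
    intro _ v hv
    rw [graphBall_zero] at hv
    rw [Set.mem_singleton_iff.1 hv]
    exact hu
  | succ k ih =>
    intro hk v hv
    rcases (mem_graphBall_succ_iff' H u v k).1 hv with rfl | ⟨v', hv', hadj⟩
    · exact hu
    · exact mem_enhSiteCluster_of_adj (ih (Nat.le_of_succ_le hk) hv') hadj (hb (graphBall_mono H u hk hv))

/-! ### Coordinates `(ω, α)` and the event `𝓔_L` -/

/-- The open sites `ω` of a joint configuration `ξ ⊆ V ⊔ V` (first summand). [cite: MartineauSevero2019, §4 ((ω, α)); §5 Remark 4] -/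
def enhSiteOmega (ξ : Set (W ⊕ W)) : Set W := Sum.inl ⁻¹' ξ

/-- The marked vertices `α` of a joint configuration `ξ ⊆ V ⊔ V` (second summand). [cite: MartineauSevero2019, §4 ((ω, α))] -/
def enhSiteAlpha (ξ : Set (W ⊕ W)) : Set W := Sum.inr ⁻¹' ξ

/-- Unfolding `enhSiteOmega`. [cite: MartineauSevero2019, §4 ((ω, α))] -/
@[simp] theorem mem_enhSiteOmega {ξ : Set (W ⊕ W)} {v : W} : v ∈ enhSiteOmega ξ ↔ Sum.inl v ∈ ξ := Iff.rfl

/-- Unfolding `enhSiteAlpha`. [cite: MartineauSevero2019, §4 ((ω, α))] -/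
@[simp] theorem mem_enhSiteAlpha {ξ : Set (W ⊕ W)} {v : W} : v ∈ enhSiteAlpha ξ ↔ Sum.inr v ∈ ξ := Iff.rfl

/-- `enhSiteOmega` is monotone. [cite: MartineauSevero2019, §6 ("increasing in both ω and α")] -/
theorem enhSiteOmega_mono {ξ ξ' : Set (W ⊕ W)} (h : ξ ⊆ ξ') : enhSiteOmega ξ ⊆ enhSiteOmega ξ' :=
  fun _ he => h he

/-- `enhSiteAlpha` is monotone. [cite: MartineauSevero2019, §6 ("increasing in both ω and α")] -/
theorem enhSiteAlpha_mono {ξ ξ' : Set (W ⊕ W)} (h : ξ ⊆ ξ') : enhSiteAlpha ξ ⊆ enhSiteAlpha ξ' :=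
  fun _ he => h he

/-- **The event `𝓔_L`** (site version): the enhanced site cluster of `o` contains a vertex at distance `≥ L`
from `o`. [cite: MartineauSevero2019, §6 (𝓔_L); §5 Remark 4] -/
def enhSiteEvent (H : SimpleGraph W) (r : ℕ) (o : W) (L : ℕ) : Set (Set (W ⊕ W)) :=
  {ξ | ∃ v, v ∈ enhSiteCluster H r {o} (enhSiteOmega ξ) (enhSiteAlpha ξ) ∧ L ≤ H.dist o v}

/-- `𝓔_L` is increasing in `(ω, α)`. [cite: MartineauSevero2019, §6 ("increasing in both ω and α")] -/
theorem isUpperSet_enhSiteEvent (H : SimpleGraph W) (r : ℕ) (o : W) (L : ℕ) :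
    IsUpperSet (enhSiteEvent H r o L) := by
  rintro ξ ξ' hle ⟨v, hv, hd⟩
  exact ⟨v, enhSiteCluster_mono H r subset_rfl (enhSiteOmega_mono hle) (enhSiteAlpha_mono hle) hv, hd⟩

/-- `𝓔_L` is decreasing in `L`. [cite: MartineauSevero2019, §6 (𝓔_L)] -/
theorem enhSiteEvent_antitone (H : SimpleGraph W) (r : ℕ) (o : W) {L L' : ℕ} (h : L ≤ L') :
    enhSiteEvent H r o L' ⊆ enhSiteEvent H r o L := by
  rintro ξ ⟨v, hv, hd⟩
  exact ⟨v, hv, h.trans hd⟩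

/-! ### The closure principle and locality -/

/-- **Closure principle** (site version). Let `S ∋ o` be closed under the two generating rules applied at
vertices `u ∈ S` with `dist(o,u) < L` (open neighbouring site; bonus at `u`). If `𝓔_L` holds for `(ω, α)`
then `S` contains a vertex at distance `≥ L`. [cite: MartineauSevero2019, §5–§6 (the exploration computes 𝒞_o; 𝓔_L is local)] -/
theorem exists_far_of_siteClosed {H : SimpleGraph W} {r : ℕ} {o : W} {L : ℕ} {ω : Set W} {α : Set W}
    (S : Set W) (ho : o ∈ S)
    (hsite : ∀ u v, u ∈ S → H.dist o u < L → H.Adj u v → v ∈ ω → v ∈ S)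
    (hbonus : ∀ u v, u ∈ S → H.dist o u < L → u ∈ α → graphBall H u r ⊆ ω → H.dist u v = r + 1 → v ∈ S)
    (hfar : ∃ v, v ∈ enhSiteCluster H r {o} ω α ∧ L ≤ H.dist o v) : ∃ v ∈ S, L ≤ H.dist o v := by
  obtain ⟨v, hv, hLv⟩ := hfar
  have key : ∀ v, v ∈ enhSiteCluster H r {o} ω α → (v ∈ S ∧ H.dist o v < L) ∨ ∃ v' ∈ S, L ≤ H.dist o v' := by
    intro v hv
    refine enhSiteCluster_induction (P := fun v => (v ∈ S ∧ H.dist o v < L) ∨ ∃ v' ∈ S, L ≤ H.dist o v')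
      ?_ ?_ ?_ hv
    · intro w hw
      rw [Set.mem_singleton_iff] at hw
      subst hw
      by_cases hL : H.dist w w < L
      · exact Or.inl ⟨ho, hL⟩
      · exact Or.inr ⟨w, ho, not_lt.1 hL⟩
    · rintro u w - (⟨huS, hud⟩ | hfar) hadj hw
      · have hwS : w ∈ S := hsite u w huS hud hadj hw
        by_cases hL : H.dist o w < L
        · exact Or.inl ⟨hwS, hL⟩
        · exact Or.inr ⟨w, hwS, not_lt.1 hL⟩
      · exact Or.inr hfar
    · rintro u w - (⟨huS, hud⟩ | hfar) hα hb hd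
      · have hwS : w ∈ S := hbonus u w huS hud hα hb hd
        by_cases hL : H.dist o w < L
        · exact Or.inl ⟨hwS, hL⟩
        · exact Or.inr ⟨w, hwS, not_lt.1 hL⟩
      · exact Or.inr hfar
  rcases key v hv with ⟨-, hlt⟩ | h
  · exact absurd hLv (not_le.2 hlt)
  · exact h

/-- In a connected graph the ball `B_n(u)` lies in `B_{m+n}(o)` when `dist(o,u) ≤ m`. [folklore] -/
private theorem graphBall_subset_graphBall_of_dist_le {H : SimpleGraph W} (hH : H.Connected) {o u : W} {m n : ℕ}
    (h : H.dist o u ≤ m) : graphBall H u n ⊆ graphBall H o (m + n) := by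
  intro v hv
  obtain ⟨w, hw⟩ := hH.exists_walk_length_eq_dist o u
  obtain ⟨w', hw'⟩ := hv
  exact ⟨w.append w', by rw [SimpleGraph.Walk.length_append]; omega⟩

/-- **Locality of `𝓔_L`** (site version). `𝓔_L` is determined by the sites inside `B_{L+r}(o)` and the marks
inside `B_L(o)` (as subsets of the coordinate type `V ⊔ V`). [cite: MartineauSevero2019, §6 ("𝓔_L, which depends only on finitely many coordinates")] -/
theorem determinedBy_enhSiteEvent {H : SimpleGraph W} (hH : H.Connected) (r : ℕ) (o : W) (L : ℕ)
    (K : Set (W ⊕ W)) (hKs : Sum.inl '' graphBall H o (L + r) ⊆ K) (hKv : Sum.inr '' graphBall H o L ⊆ K) :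
    DeterminedBy (enhSiteEvent H r o L) K := by
  suffices h : ∀ ξ ξ' : Set (W ⊕ W), ξ ∩ K = ξ' ∩ K → ξ ∈ enhSiteEvent H r o L → ξ' ∈ enhSiteEvent H r o L by
    rw [determinedBy_iff]
    intro ξ ξ' hK
    exact ⟨h ξ ξ' hK, h ξ' ξ hK.symm⟩
  intro ξ ξ' hK hξ
  have hagree : ∀ i ∈ K, i ∈ ξ → i ∈ ξ' := fun i hi hiξ =>
    ((Set.ext_iff.1 hK i).1 ⟨hiξ, hi⟩).1
  have hdist : ∀ {u : W} {n : ℕ}, H.dist o u ≤ n → u ∈ graphBall H o n := fun {u n} hu => by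
    obtain ⟨w, hw⟩ := hH.exists_walk_length_eq_dist o u
    exact ⟨w, by omega⟩
  refine exists_far_of_siteClosed (ω := enhSiteOmega ξ) (α := enhSiteAlpha ξ)
    (enhSiteCluster H r {o} (enhSiteOmega ξ') (enhSiteAlpha ξ')) (subset_enhSiteCluster _ _ _ _ _ rfl) ?_ ?_ hξ
  · intro u w hu hud hadj hw
    refine mem_enhSiteCluster_of_adj hu hadj (hagree _ (hKs ⟨w, ?_, rfl⟩) hw)
    have : w ∈ graphBall H o (L + r) := by
      obtain ⟨p, hp⟩ := hH.exists_walk_length_eq_dist o u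
      exact ⟨p.concat hadj, by rw [SimpleGraph.Walk.length_concat]; omega⟩
    exact this
  · intro u w hu hud hα hb hd
    refine mem_enhSiteCluster_of_bonus hu (hagree _ (hKv ⟨u, hdist hud.le, rfl⟩) hα) (fun v hv => ?_) hd
    exact hagree _ (hKs ⟨v, graphBall_subset_graphBall_of_dist_le hH hud.le hv, rfl⟩) (hb hv)

/-- The finite **window** of coordinates `B_{L+r}(o) ⊔ B_L(o)` determining `𝓔_L`.
[cite: MartineauSevero2019, §6 (finitely many coordinates)] -/
noncomputable def enhSiteWindow (H : SimpleGraph W) [H.LocallyFinite] (r : ℕ) (o : W) (L : ℕ) : Finset (W ⊕ W) :=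
  (ballFin H o (L + r)).disjSum (ballFin H o L)

/-- Membership of a site coordinate in the window. [cite: MartineauSevero2019, §6 (finitely many coordinates)] -/
@[simp] theorem inl_mem_enhSiteWindow {H : SimpleGraph W} [H.LocallyFinite] {r : ℕ} {o : W} {L : ℕ} {v : W} :
    (Sum.inl v : W ⊕ W) ∈ enhSiteWindow H r o L ↔ v ∈ graphBall H o (L + r) := by
  simp [enhSiteWindow]

/-- Membership of a mark coordinate in the window. [cite: MartineauSevero2019, §6 (finitely many coordinates)] -/
@[simp] theorem inr_mem_enhSiteWindow {H : SimpleGraph W} [H.LocallyFinite] {r : ℕ} {o : W} {L : ℕ} {v : W} :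
    (Sum.inr v : W ⊕ W) ∈ enhSiteWindow H r o L ↔ v ∈ graphBall H o L := by
  simp [enhSiteWindow]

/-- **`𝓔_L` is determined by the window.** [cite: MartineauSevero2019, §6] -/
theorem determinedBy_enhSiteEvent_enhSiteWindow {H : SimpleGraph W} [H.LocallyFinite] (hH : H.Connected)
    (r : ℕ) (o : W) (L : ℕ) : DeterminedBy (enhSiteEvent H r o L) ↑(enhSiteWindow H r o L) := by
  refine determinedBy_enhSiteEvent hH r o L _ ?_ ?_
  · rintro _ ⟨v, hv, rfl⟩
    exact Finset.mem_coe.2 (inl_mem_enhSiteWindow.2 hv)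
  · rintro _ ⟨v, hv, rfl⟩
    exact Finset.mem_coe.2 (inr_mem_enhSiteWindow.2 hv)

end Literature.Probability.Percolation
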